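import Summits.QuantumFields.BalabanUV.Beta.CombChartStepJets
import Summits.QuantumFields.BalabanUV.Beta.KernelWardHColumnSym
import Summits.QuantumFields.BalabanUV.Beta.AxialDressingRootedHessian

/-!
# `BalabanUV.Beta.CombChartHColumnWard` — binder row D1, RULING R-D1-g35-1 (chart (III′)), brick P4w-i: **THE ℋ-COLUMN WARD LAW OF THE COMB-CHART
# RESOLVENT `G′_j = GcombSh Lc j`** — the socket `hH` of the relative Ward END (`KernelWardRelative.wardTransversal_flipK_hessKer_conj_rel`) and of the (Sd)
# induction (`WardLocusInductionBorder.hSd_all_border`) at `K := GcombSh Lc j`, with the SAME constant family `cH j = (stepScale d Lc j · Lc^{d+1})⁻¹` as chart (II)'s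
# `KernelWardHColumnSym.colH_ward_coDressKSymAt_KInvStep`

HONEST FRAMING (cell contract, verbatim): «discharging `BetaPertH` makes Bałaban's UV stability UNCONDITIONAL — a real constructive-QFT
result; it is NOT the continuum limit and NOT the Clay problem.»  HONEST DEPENDENCY: continuum YM on T⁴ ⇐ BetaPertH ∧ nine spine estimates (0/9 proved);
BetaPertH ⇐ (D1) ∧ (D4) ∧ CAP+tail; G-an2-4 gates asym, D1 and NE2/3/4.
DERIVED cell leaf ([folklore] finite window bookkeeping BY NAME; β sub-cell, BINDER-OWNERS row D1 OWNER `b2b-balaban-beta-an2` gen 36).  No statement of Bałaban's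
papers, no `[cite:]`, no `Prop` fact, no `def`.  MECHANISM: the `ℋ`-column of a co-dressed kernel is the windowed rooted projector `coProjW ρ N` applied to the
`ℋ`-column (`AxialDressingRootedHessian.colH_coDressKAt_eq`); the coarse divergence commutes with that (finite) window operator; the pure-gauge weight
`gaugeWt N y = d(1_{B(y)})` vanishes on COMB bonds (a comb bond never crosses a block boundary — the second clause of `IsCombBondAt`), and `Π_ρ` FIXES every one-form
vanishing on the comb bonds (`pm_of_not_isCombBond`, `pm_eq_zero_of_isCombBond`): so `G′_j` inherits `G_j`'s law with the same constant.
WHAT: §1 `coProjW_eq_self_of_comb_zero` (in-block root: `Π_ρ`'s window operator fixes one-forms vanishing on comb bonds), `gaugeWt_eq_zero_of_isCombBond`,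
`coProjW_gaugeWt`; §2 **`colH_ward_coDressKAt_of_ward`** (generic `K`: an `ℋ`-column Ward law with constant `c` passes to `coDressKAt (toSite r) N K` with the SAME `c`);
§3 the instance **`colH_ward_GcombSh`**: `Σ_μ (colH G′_j Lc μ (y − e_μ) κ′ u − colH G′_j Lc μ y κ′ u) = (stepScale d Lc j · Lc^{d+1})⁻¹ · gaugeWt Lc y κ′ u`, every `j`.
Discharges NO binder of the row by itself; NOT D1, NOT `BetaPertH`, NOT continuum, NOT Clay.
Provenance: β sub-cell, unit beta-an2 gen 36, 2026-08-22 (v1); over `CombChartStepJets` (P3), `KernelWardHColumnSym`, `AxialDressingRooted{,Hessian}`, `AxialCoordinateProjector`,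
`CombChartResolventRules` §4 BY NAME; no existing file touched.
-/

noncomputable section

open Finset
open scoped BigOperators
open Literature.Probability.LatticeModels (Torus.proj)
open Literature.MathematicalPhysics.QuantumFieldTheory
open Literature.MathematicalPhysics.QuantumFieldTheory.Balaban1983to89
open Literature.MathematicalPhysics.QuantumFieldTheory.Balaban1983to89.Beta
open ExpKernelCalculus (MKer)
open AffineAveraging (Form1 box toSite)
open AveragingContours (blk)
open AveragingContoursRooted (ctr ctrOff ctrOff_mem_box)
open OneStepResolventKernel (Fib)
open OneStepKernelFamily (KInvStep colH)
open Summit.QuantumFields.BalabanUV.Beta.TameKernelCalculus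
open Summit.QuantumFields.BalabanUV.Beta.AxialDressingRooted (one_le_of_neZero pm cube zero_mem_cube coDressKAt coProjW coProjW_apply colH_coDressKAt_eq
  IsCombBondAt pm_eq_zero_of_isCombBond)
open Summit.QuantumFields.BalabanUV.Beta.BorderedHessian (stepScale)
open Summit.QuantumFields.BalabanUV.Beta.KernelWardRelative (gaugeWt)
open Summit.QuantumFields.BalabanUV.Beta.SymmetrisedStepJets (Gsym Gsym_apply)
open Summit.QuantumFields.BalabanUV.Beta.KernelWardHColumnSym (colH_ward_coDressKSymAt_KInvStep)
open Summit.QuantumFields.BalabanUV.Beta.CombChartResolventRules (pm_of_not_isCombBond)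
open Summit.QuantumFields.BalabanUV.Beta.CombChartStepJets (GcombSh GcombSh_apply)

namespace Summit.QuantumFields.BalabanUV.Beta.CombChartHColumnWard

variable {d : ℕ}

/-! ## §1 The window operator of the rooted projector fixes one-forms vanishing on the comb bonds; the pure-gauge weight is such a form -/

section Window

variable {N : ℕ}

open Classical in
/-- [folklore] **`Π_ρ`'s WINDOW OPERATOR FIXES EVERY ONE-FORM VANISHING ON THE COMB BONDS** (in-block root): for such `A`, `coProjW (toSite r) N A = A`.
On a comb row every matrix entry vanishes (`pm_eq_zero_of_isCombBond`) and so does `A`; on a non-comb row the comb columns carry `A = 0` and the non-comb columns carry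
the identity matrix (`pm_of_not_isCombBond`). -/
theorem coProjW_eq_self_of_comb_zero (hN : 1 ≤ N) {r : Fin (d + 1) → ℕ} (hr : r ∈ box (d + 1) N) {A : Form1 (d + 1) ℝ}
    (hA : ∀ (κ : Fin (d + 1)) (w : Fin (d + 1) → ℤ), IsCombBondAt (toSite r) N κ w → A κ w = 0) :
    coProjW (toSite r) N A = A := by
  funext κ' u'
  rw [coProjW_apply]
  by_cases hc : IsCombBondAt (toSite r) N κ' u'
  · rw [hA κ' u' hc]
    exact Finset.sum_eq_zero fun v _ => Finset.sum_eq_zero fun κ _ => by rw [pm_eq_zero_of_isCombBond hc, Int.cast_zero, zero_mul]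
  · have hterm : ∀ (v : Fin (d + 1) → ℤ) (κ : Fin (d + 1)),
        (pm (toSite r) N κ' u' κ (u' - v) : ℝ) * A κ (u' - v) = (if v = 0 then (1 : ℝ) else 0) * (if κ = κ' then A κ' u' else 0) := by
      intro v κ
      by_cases hcw : IsCombBondAt (toSite r) N κ (u' - v)
      · rw [hA κ _ hcw, mul_zero]
        by_cases hv : v = 0
        · by_cases hk : κ = κ'
          · subst hv; subst hk
            rw [sub_zero] at hcw
            exact absurd hcw hc
          · rw [if_neg hk, mul_zero]
        · rw [if_neg hv, zero_mul]
      · rw [pm_of_not_isCombBond hN hr hcw]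
        by_cases hv : v = 0
        · subst hv
          by_cases hk : κ = κ'
          · subst hk
            rw [if_pos ⟨rfl, (sub_zero u').symm⟩, sub_zero, Int.cast_one, one_mul, if_pos rfl, if_pos rfl, one_mul]
          · rw [if_neg (fun h => hk h.1.symm), Int.cast_zero, zero_mul, if_pos rfl, if_neg hk, mul_zero]
        · rw [if_neg, Int.cast_zero, zero_mul, if_neg hv, zero_mul]
          rintro ⟨_, h2⟩
          exact hv (by rw [eq_comm, sub_eq_self] at h2; exact h2)
    simp_rw [hterm, ← Finset.mul_sum, ← Finset.sum_mul]
    rw [Finset.sum_ite_eq' Finset.univ κ' (fun _ => A κ' u'), if_pos (Finset.mem_univ _),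
      Finset.sum_ite_eq' (cube (d + 1) N) (0 : Fin (d + 1) → ℤ) (fun _ => (1 : ℝ)), if_pos (zero_mem_cube N), one_mul]

/-- [folklore] **THE PURE-GAUGE WEIGHT VANISHES ON COMB BONDS** (a comb bond never crosses a block boundary: the second clause of `IsCombBondAt`;
the two unit-vector conventions agree, `WardBorderReflection.unitVec_eq`, re-derived inline to keep the import light). -/
theorem gaugeWt_eq_zero_of_isCombBond {ρ : Fin (d + 1) → ℤ} (y : Fin (d + 1) → ℤ) {κ : Fin (d + 1)} {w : Fin (d + 1) → ℤ}
    (h : IsCombBondAt ρ N κ w) : gaugeWt N y κ w = 0 := by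
  have e : (B6BondElimination.unitVec κ : Fin (d + 1) → ℤ) = AffineAveraging.unitVec κ := by
    funext i
    simp only [B6BondElimination.unitVec, AffineAveraging.unitVec, Pi.single_apply]
  unfold gaugeWt
  rw [e, h.2, sub_self]

/-- [folklore] **`Π_ρ`'s WINDOW OPERATOR FIXES THE PURE-GAUGE WEIGHT**: `coProjW (toSite r) N (gaugeWt N y) = gaugeWt N y` (in-block root). -/
theorem coProjW_gaugeWt (hN : 1 ≤ N) {r : Fin (d + 1) → ℕ} (hr : r ∈ box (d + 1) N) (y : Fin (d + 1) → ℤ) :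
    coProjW (toSite r) N (gaugeWt N y) = gaugeWt N y :=
  coProjW_eq_self_of_comb_zero hN hr fun _ _ h => gaugeWt_eq_zero_of_isCombBond y h

end Window

/-! ## §2 An ℋ-column Ward law passes to the co-dressed kernel with the same constant -/

section CoDress

variable {N : ℕ}

/-- [folklore] **THE ℋ-COLUMN WARD LAW OF `coDressKAt ρ N K` FROM THAT OF `K`, SAME CONSTANT** (in-block root).  If
`Σ_μ (colH K N μ (y − e_μ) κ′ u − colH K N μ y κ′ u) = c · gaugeWt N y κ′ u` for all `κ′ u`, then the same holds for `coDressKAt (toSite r) N K`: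
`colH (coDressKAt …) = coProjW (colH K …)` column by column, the finite window commutes with the coarse divergence, and `coProjW` fixes `gaugeWt N y`. -/
theorem colH_ward_coDressKAt_of_ward (hN : 1 ≤ N) {r : Fin (d + 1) → ℕ} (hr : r ∈ box (d + 1) N) {K : MKer (d + 1) (Fib d)} {c : ℝ}
    (y : Fin (d + 1) → ℤ)
    (hK : ∀ (κ' : Fin (d + 1)) (u : Fin (d + 1) → ℤ),
      ∑ μ, (colH K N μ (y - B6BondElimination.unitVec μ) κ' u - colH K N μ y κ' u) = c * gaugeWt N y κ' u)
    (κ' : Fin (d + 1)) (u : Fin (d + 1) → ℤ) :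
    ∑ μ, (colH (coDressKAt (toSite r) N K) N μ (y - B6BondElimination.unitVec μ) κ' u - colH (coDressKAt (toSite r) N K) N μ y κ' u) =
      c * gaugeWt N y κ' u := by
  have hcol : ∀ (μ : Fin (d + 1)) (y' : Fin (d + 1) → ℤ),
      colH (coDressKAt (toSite r) N K) N μ y' κ' u = coProjW (toSite r) N (colH K N μ y') κ' u := fun μ y' => by
    rw [colH_coDressKAt_eq]
  simp_rw [hcol, coProjW_apply, ← Finset.sum_sub_distrib, ← mul_sub]
  rw [show (∑ μ : Fin (d + 1), ∑ v ∈ cube (d + 1) N, ∑ κ : Fin (d + 1),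
        (pm (toSite r) N κ' u κ (u - v) : ℝ) * (colH K N μ (y - B6BondElimination.unitVec μ) κ (u - v) - colH K N μ y κ (u - v))) =
      ∑ v ∈ cube (d + 1) N, ∑ κ : Fin (d + 1), (pm (toSite r) N κ' u κ (u - v) : ℝ) *
        ∑ μ : Fin (d + 1), (colH K N μ (y - B6BondElimination.unitVec μ) κ (u - v) - colH K N μ y κ (u - v)) by
    rw [Finset.sum_comm]
    refine Finset.sum_congr rfl fun v _ => ?_
    rw [Finset.sum_comm]
    refine Finset.sum_congr rfl fun κ _ => ?_
    rw [Finset.mul_sum]]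
  simp_rw [hK, mul_left_comm _ c, ← Finset.mul_sum]
  have hfix := congrFun (congrFun (coProjW_gaugeWt hN hr y) κ') u
  rw [coProjW_apply] at hfix
  rw [hfix]

end CoDress

/-! ## §3 The instance: the comb-chart resolvents `G′_j`, every step -/

section Instance

variable {Lc : ℕ} [NeZero Lc]

/-- [folklore] **THE ℋ-COLUMN WARD LAW OF `G′_j = GcombSh Lc j` AT EVERY STEP** — the socket `hH` of the (III′) Ward END and of the (III′) (Sd) induction with
`cH j = (stepScale d Lc j · Lc^{d+1})⁻¹`: §2 at `K := Gsym Lc j` (chart (II)'s `KernelWardHColumnSym.colH_ward_coDressKSymAt_KInvStep`), root `ctrOff (d+1) Lc`. -/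
theorem colH_ward_GcombSh (j : ℕ) (y : Fin (d + 1) → ℤ) (κ' : Fin (d + 1)) (u : Fin (d + 1) → ℤ) :
    ∑ μ, (colH (GcombSh (d := d) Lc j) Lc μ (y - B6BondElimination.unitVec μ) κ' u - colH (GcombSh (d := d) Lc j) Lc μ y κ' u) =
      (stepScale d Lc j * (Lc : ℝ) ^ (d + 1))⁻¹ * gaugeWt Lc y κ' u := by
  rw [GcombSh_apply]
  exact colH_ward_coDressKAt_of_ward (one_le_of_neZero Lc) (ctrOff_mem_box (one_le_of_neZero Lc)) y
    (fun κ' u => by rw [Gsym_apply]; exact colH_ward_coDressKSymAt_KInvStep (d := d) (Lc := Lc) j y κ' u) κ' u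

end Instance

end Summit.QuantumFields.BalabanUV.Beta.CombChartHColumnWard

end
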